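import Summits.Ventures.HSemireg.S4BridgeSplitPoint
import Summits.Ventures.HSemireg.Leverage
import Summits.HodgeConjecture.HodgeConjecture.Theorems.Ring2AbelianAllEvenTimesEvenComponents
import HarnessLib

/-!
# Venture HSemireg — S4-PUSH bridge (B2), LADDER form: every member of every discriminant component `(n, K, δ)` is a
# FACTOR of a split product point one rung up, and the split component one rung up decides every component below

HONEST FRAMING. Bridge-typing file of the computation cell `pub-hsemireg` (track «S4-PUSH» (iii), seat s4-bridge-2;
companion of `S4BridgeSplitPoint.lean` = (B2) in the CONTAINMENT reading «every discriminant component CONTAINS a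
product point», typing note `s4push/B2-TYPING-s4-bridge-2.md`). This file types the OTHER printed meaning of «a split
point in each discriminant component» — the LADDER reading ruled by the S4 sub-lead (S4-R1′: «(B2) … is the LADDER
descent, which only has content from a rung ABOVE») and printed by Markman / Schoen / Voisin — with the COMPONENT DATA
EXPLICIT (`δ ∈ ℚˣ/Nm(K_dˣ)` on both factors and on the product), as THEOREMS assembled from the tree (0 sorry; no new
definition; no named fact consumed). Nothing here bears on any open case of the Hodge conjecture; no object of the cell
is certified; HC / HC_CM / HC_AV are NOT proved. «Split point» = PRODUCT point (referee protocol §3 (B2) trap (i)).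

## The statements (component data explicit; polarisation and `K`-action part of the data)

Conventions as in `S4BridgeSplitPoint.lean`: the typed component `(n, d, δ)` consists of the polarized triples
`(A, φ, h_K = d·e^*a + φ^*e^*a)` with `VanGeemen1994.HasWeilDiscriminantNondeg A φ n d h_K δ`; the split class at
rank `n` is `splitDiscriminantClass n d = [(-1)ⁿ]` (van Geemen (5.4.1); Markman §11.5 Step 1).

* `exists_cmSquare_partner_prod_isSplitWeilType` — **(B2-L) the ladder product point.** For every member
  `(A, φ, h_K)` of Weil type `(n, d)` of the component `(n, d, δ)` there are a CM elliptic curve `(E₀, ψ₀)` and a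
  PARTNER `(S, ψ, h_S)`: a product point over `E₀` (`IsCMProductPoint E₀ ψ₀ S ψ` — in the proof the CM square
  `(E₀ × E₀, ψ₀ × (-ψ₀))`), a Weil-type SURFACE lying in the component `(1, d, δ·[(-1)ⁿ⁺¹])` of COMPLEMENTARY class,
  such that the product `(A × S, φ × ψ)` carries a `K`-symmetrised hyperplane class of class `[(-1)ⁿ⁺¹]` — it lies
  in the SPLIT component `(n + 1, d, [(-1)ⁿ⁺¹])` — and is of SPLIT Weil type (`HodgeTheory.IsSplitWeilType`, some
  `K`-symmetrised hyperplane class hyperbolic). AS PRINTED (n = 2 ⇒ sixfolds): [Markman2025SurveySecant] §11.5 Step 2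
  (arXiv:2509.23403 public PDF p. 21; the cell's referee protocol quotes the held chunk p0019 L20–26): «The discriminant
  invariant of polarized abelian varieties with complex multiplication by the same field is multiplicative under
  cartesian products. Every value in `ℚ^×/Nm_{K/ℚ}(K^×)` is realized as the discriminant by some connected component
  of moduli in every even dimension [vG, Th. 5.2]. Hence, for every polarized abelian fourfold `(A₁, η₁, h₁)` of Weil
  type, of arbitrary discriminant, there exists a polarized abelian surface of Weil type `(A₂, η₂, h₂)`, such that the
  discriminant of their product polarized abelian sixfold of Weil type `(A₁ × A₂, η, π₁^*h₁ + π₂^*h₂)` is the coset of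
  `-1`. The sixfold is hence of split type […]»; [Markman2025SecantWeil] Cor. 1.6.1, proof (v2 p. 9): «by degenerating
  abelian sixfolds of Weil type of discriminant `-1` to products of abelian fourfolds of Weil type of arbitrary
  discriminant and abelian surfaces of Weil type [S2, Prop. 10]»; [Voisin2026BourbakiMarkman] Lemme 2.9 (p. 16):
  «Le produit `A₁ × A₂` de deux variétés abéliennes de Weil de même corps `K` associé et de discriminants respectifs
  `δ₁, δ₂` est une variété abélienne de Weil de discriminant `δ₁δ₂`»; the classification behind it =
  [vanGeemen1994HodgeAV] 4.14, Lemma 5.2 (3)–(4), 5.4 (5.4.1) (Landherr). TYPED FOR ALL `n` (printed sentence at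
  `n = 2`; Markman's «in every even dimension» covers the realisation clause) — named, not silent. Kernel inputs:
  (B2) `splitPointInEachDiscriminantComponent_holds` at `n = 1` (the partner), ring 2's component multiplication law
  `Ring2.AbelianAll.exists_ksymm_hasWeilDiscriminantNondeg_prod` («det H is multiplicative», our formalisation of
  Markman's sentence), `δ² = 1` (`weilNormResidueGroup_mul_self`), and Landherr's converse on the carriers
  (`VanGeemen1994.IsWeilType.isSplitWeilType_of_hasWeilDiscriminantNondeg_split`).
* `weilClassesComponent_of_split_component_succ` — **(B2-L′) the descent, component currency.** For `n ≥ 2`, `d ≥ 1`: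
  the class target of the SPLIT component one rung up, `Ring2.Hypotheses.WeilClassesComponent (n+1) d [(-1)ⁿ⁺¹]`,
  implies the class target `WeilClassesComponent n d δ` of EVERY component `(n, d, δ)`. AS PRINTED: Markman §11.5
  Step 2 (last two sentences, p. 21): «The sixfold is hence of split type and so its Weil classes are algebraic. It
  follows that the Weil classes of `(A₁, η₁, h₁)` are algebraic, by [S2, Prop. 10]. Hence, the Weil classes are
  algebraic on every abelian fourfold.»; [Schoen1998HodgeWeilAddendum] 10 (Proposition), pp. 332–333 (Compositio 114; the Addendum numbers PARAGRAPHS, «10. PROPOSITION» = ¶10), the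
  transfer `W(A × S)` algebraic ⟹ `W(A)` algebraic. Kernel inputs: the tree's PROVED descent edge `stub_descend`
  (`Stubs.WeilAlgebraicSplitHyperplane (n+1) d → WeilAlgebraicAll n d`: partner surfaces
  `exists_weilTypeSurface_prod_isHyperbolicWeilType_all_holds` + Schoen's transfer
  `Schoen1998_weilClasses_algebraic_of_prod_surface_all_holds`, both THEOREMS; see `Leverage.lean`) and ring 2's
  `weilClasses_algebraic_of_isHyperbolicWeilType_of_split_component` (hyperbolic ⟹ in the split cell).
  This is the sense in which a rung ABOVE decides the components below (STRUCTURE §3.0 «THE LADDER»; S4-R1′).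

## Scope / readings NAMED
* «Component», «split point», «isogenous ≠ isomorphic», «polarisation + η in the data»: as in `S4BridgeSplitPoint.lean`
  (referee traps (i)–(iv)). The product polarisation here is the `K`-symmetrised Segre class of ring 2's multiplication
  law (`pr_A^* h_A + c · pr_S^* h_S`, `c ∈ ℚˣ`), i.e. Markman's `π₁^*h₁ + π₂^*h₂` up to a rational rescaling of the
  second summand (class unchanged: `hasWeilDiscriminantNondeg_ratCast_smul_iff`) — typed weaker-or-equal, named.
* Not here: any semiregular object; the (S4) existence clause; anything about `HC_AV`.

References: [Markman2025SurveySecant] arXiv:2509.23403 (UNREFEREED) §11.5 Steps 1–2 · [Markman2025SecantWeil]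
arXiv:2502.03415 v2 (UNREFEREED) Cor. 1.6.1 and proof · [Schoen1998HodgeWeilAddendum] Compositio Math. 114 (1998) ¶10
(Proposition), p. 332 · [vanGeemen1994HodgeAV] LNM 1594 (1994) 4.14, Lemma 5.2, 5.4 (5.4.1) · [vanGeemen2022WeilDecomposable] SIGMA 18
(2022) 097 §7.3 · [Landherr1936HermitianForms].
-/

noncomputable section

open CategoryTheory MonoidalCategory AlgebraicGeometry
open Literature.AlgebraicGeometry Literature.AlgebraicGeometry.Motives
open Literature.AlgebraicGeometry.HodgeTheory
open Literature.AlgebraicGeometry.VanGeemen1994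
open Literature.AlgebraicTopology.SingularHomology
open Summit.HodgeConjecture.HodgeConjecture.Ring2.Hypotheses
open Summit.HodgeConjecture.HodgeConjecture.Ring2.AbelianAll
open Summit.HodgeConjecture.HodgeConjecture.Cruxes.HodgeAbelianVarieties.EStepSecantInduction
open Summit.HodgeConjecture.HodgeConjecture.Cruxes.HodgeAbelianVarieties.PrymCanonicalZ3SplitSeeds.Stubs.Descend
  (stub_descend)

namespace Summit.Ventures.HSemireg

/-! ### §1 Sign bookkeeping: the complementary class one rung up is a SURFACE class -/

/-- If `sign δ = (-1)ⁿ` then the complementary class `δ · [(-1)ⁿ⁺¹]` has sign `-1 = (-1)¹`, the sign of the Weil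
SURFACE components (van Geemen 4.14: the inhabited classes at rank `n` are those with `(-1)ⁿ x > 0`).
[cite: vanGeemen1994HodgeAV, 4.14 and Lemma 5.2 (4)] -/
theorem weilSign_mul_mk_neg_one_pow_succ {d n : ℕ} {δ : weilNormResidueGroup d} (hδ : weilSign d δ = (-1) ^ n) :
    weilSign d (δ * QuotientGroup.mk ((-1 : ℚˣ) ^ (n + 1))) = (-1) ^ 1 := by
  rw [map_mul, hδ, weilSign_mk_neg_one_pow]
  -- `^` on `ℤˣ` elaborates through `Int.instUnitsPow` (definitionally the monoid power): split on `(-1)ⁿ = ±1`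
  rcases Int.units_eq_one_or ((-1 : ℤˣ) ^ n) with h | h
  · rw [show ((-1 : ℤˣ) ^ (n + 1 : ℕ)) = (-1) ^ (n : ℕ) * (-1) from pow_succ _ _, h]; simp
  · rw [show ((-1 : ℤˣ) ^ (n + 1 : ℕ)) = (-1) ^ (n : ℕ) * (-1) from pow_succ _ _, h]; simp

/-- `δ · (δ · u) = u` in the `2`-torsion group `ℚˣ/Nm(K_dˣ)`. [cite: vanGeemen1994HodgeAV, 4.14] -/
theorem mul_mul_self_cancel {d : ℕ} (δ u : weilNormResidueGroup d) : δ * (δ * u) = u := by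
  rw [← mul_assoc, weilNormResidueGroup_mul_self, one_mul]

/-! ### §2 (B2-L): every member of every component is a factor of a SPLIT product point one rung up -/

/-- **(B2-L) THE LADDER PRODUCT POINT, component data explicit.** Let `(A, φ)` be of Weil type `(n, d)` and let its
`K`-symmetrised hyperplane class `h_K = d·e^*a + φ^*e^*a` have non-degenerate discriminant class `δ` (a member of the
component `(n, d, δ)`). Then there are a CM elliptic curve `(E₀, ψ₀)` (`dim E₀ = 1`, `ψ₀ ≫ ψ₀ = -d`), a PARTNER Weil
SURFACE `(S, ψ, h_S)` which is a product point over `E₀` (`IsCMProductPoint E₀ ψ₀ S ψ`), of Weil type `(1, d)`, in the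
component `(1, d, δ·[(-1)ⁿ⁺¹])` of complementary class, and a `K`-symmetrised hyperplane class `h'` on the PRODUCT
`(A × S, φ × ψ)` of class `[(-1)ⁿ⁺¹]` — the product lies in the SPLIT component `(n+1, d, [(-1)ⁿ⁺¹])` — with
`(A × S, φ × ψ)` of SPLIT Weil type `(n+1, d)`. Markman §11.5 Step 2 («for every polarized abelian fourfold … of
arbitrary discriminant, there exists a polarized abelian surface of Weil type … such that the discriminant of their
product … is the coset of `-1`. The sixfold is hence of split type»), typed for all `n`.
[cite: Markman2025SurveySecant, §11.5 Steps 1–2 (p. 21)] [cite: Markman2025SecantWeil, Cor. 1.6.1 (proof)]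
[cite: vanGeemen1994HodgeAV, 4.14, Lemma 5.2 (3)–(4) and 5.4 (5.4.1)] [cite: Landherr1936HermitianForms] -/
theorem exists_cmSquare_partner_prod_isSplitWeilType {n d : ℕ} {A : AbelianVariety ℂ} {φ : A ⟶ A}
    (hW : IsWeilType A φ n d) (e : ProjectiveEmbedding A.X) {a : complexBetti (projectiveSpace e.n ℂ) 2}
    (ha : IsRationalClass a) (ha0 : a ≠ 0) {δ : weilNormResidueGroup d}
    (hδ : HasWeilDiscriminantNondeg A φ n d
      ((d : ℂ) • complexBetti.map e.ι 2 a + complexBetti.map φ.hom.hom.hom 2 (complexBetti.map e.ι 2 a)) δ) :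
    ∃ (E₀ : AbelianVariety ℂ) (ψ₀ : E₀ ⟶ E₀) (S : AbelianVariety ℂ) (ψ : S ⟶ S) (eS : ProjectiveEmbedding S.X)
      (aS : complexBetti (projectiveSpace eS.n ℂ) 2) (e' : ProjectiveEmbedding (A.prod S).X)
      (a' : complexBetti (projectiveSpace e'.n ℂ) 2),
      E₀.dim = 1 ∧ ψ₀ ≫ ψ₀ = -(d • 𝟙 E₀) ∧ IsCMProductPoint E₀ ψ₀ S ψ ∧ IsWeilType S ψ 1 d ∧
      IsRationalClass aS ∧ aS ≠ 0 ∧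
      HasWeilDiscriminantNondeg S ψ 1 d
        ((d : ℂ) • complexBetti.map eS.ι 2 aS + complexBetti.map ψ.hom.hom.hom 2 (complexBetti.map eS.ι 2 aS))
        (δ * QuotientGroup.mk ((-1 : ℚˣ) ^ (n + 1))) ∧
      IsRationalClass a' ∧ a' ≠ 0 ∧
      HasWeilDiscriminantNondeg (A.prod S)
        (AbelianVariety.prodLift (AbelianVariety.fst A S ≫ φ) (AbelianVariety.snd A S ≫ ψ)) (n + 1) d
        ((d : ℂ) • complexBetti.map e'.ι 2 a' +
          complexBetti.map (AbelianVariety.prodLift (AbelianVariety.fst A S ≫ φ)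
            (AbelianVariety.snd A S ≫ ψ)).hom.hom.hom 2 (complexBetti.map e'.ι 2 a'))
        (QuotientGroup.mk ((-1 : ℚˣ) ^ (n + 1))) ∧
      IsSplitWeilType (A.prod S)
        (AbelianVariety.prodLift (AbelianVariety.fst A S ≫ φ) (AbelianVariety.snd A S ≫ ψ)) (n + 1) d := by
  -- the member's class has the right sign, so the complementary class is a surface class
  have hsgn : weilSign d δ = (-1) ^ n := weilSign_eq_of_hasWeilDiscriminantNondeg hW e ha ha0 hδ
  -- (B2) at rank 1: a CM product point (the CM square) in the component `(1, d, δ·[(-1)ⁿ⁺¹])`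
  obtain ⟨E₀, ψ₀, S, ψ, eS, aS, hE, hψ, hP, hWS, haS, haS0, hNS⟩ :=
    splitPointInEachDiscriminantComponent_holds 1 d one_pos hW.d_pos _ (weilSign_mul_mk_neg_one_pow_succ hsgn)
  -- component multiplication law: `(n, δ) · (1, δ·[(-1)ⁿ⁺¹]) ↦ (n + 1, [(-1)ⁿ⁺¹])`
  obtain ⟨e', a', ha', ha'0, hN'⟩ := exists_ksymm_hasWeilDiscriminantNondeg_prod hW.pos hWS.pos hW.dim_eq
    hWS.dim_eq hW.d_pos hW.sq_eq hWS.sq_eq e ha ha0 eS haS haS0 hδ hNS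
  rw [mul_mul_self_cancel] at hN'
  -- Landherr's converse on the carriers: the split cell consists of split-Weil-type pairs
  exact ⟨E₀, ψ₀, S, ψ, eS, aS, e', a', hE, hψ, hP, hWS, haS, haS0, hNS, ha', ha'0, hN',
    Literature.AlgebraicGeometry.VanGeemen1994.IsWeilType.isSplitWeilType_of_hasWeilDiscriminantNondeg_split
      (isWeilType_prod hW hWS) e' ha' ha'0 hN'⟩

/-! ### §3 (B2-L′): the split component one rung up decides every component below -/

/-- **(B2-L′) THE DESCENT in component currency.** For `n ≥ 2`, `d ≥ 1`: if every rational `(n+1, n+1)` Weil class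
of every member of the SPLIT component `(n+1, d, [(-1)ⁿ⁺¹])` is algebraic
(`Ring2.Hypotheses.WeilClassesComponent (n+1) d (splitDiscriminantClass (n+1) d)`), then the same holds on EVERY
component `(n, d, δ)`, `δ ∈ ℚˣ/Nm(K_dˣ)` arbitrary. Markman §11.5 Step 2 / Cor. 1.6.1 proof («degenerating … to
products of abelian fourfolds of Weil type of arbitrary discriminant and abelian surfaces of Weil type [S2, Prop. 10]»;
Schoen's Prop. 10 is the transfer), typed for all `n ≥ 2` through the tree's PROVED descent edge `stub_descend`
(partner surfaces + Schoen's transfer, both THEOREMS) and ring 2's «hyperbolic ⟹ in the split cell».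
[cite: Markman2025SurveySecant, §11.5 Step 2 (p. 21)] [cite: Markman2025SecantWeil, Cor. 1.6.1 (proof)]
[cite: Schoen1998HodgeWeilAddendum, 10 (Proposition), p. 332] [cite: vanGeemen1994HodgeAV, 5.4 (5.4.1) and 5.5] -/
theorem weilClassesComponent_of_split_component_succ {n d : ℕ} (hn : 2 ≤ n) (hd : 0 < d)
    (h : WeilClassesComponent (n + 1) d (splitDiscriminantClass (n + 1) d)) (δ : weilNormResidueGroup d) :
    WeilClassesComponent n d δ := by
  -- the split cell one rung up gives the split hyperplane sector one rung up, hence everything one rung down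
  have W : WeilAlgebraicAll n d := by
    refine stub_descend n d hn hd ?_
    intro B ψ e a hB hψ ha ha0 hhyp c hcW hc hH
    exact weilClasses_algebraic_of_isHyperbolicWeilType_of_split_component (by omega) hd h hB
      (isSmoothProjective_of_dim_eq' hB) hψ e ha ha0 hhyp hc hH hcW
  intro A φ hA _hX hφ _e _a _ha _ha0 _hδ c hcQ hcH hw
  exact W A φ hA hφ c hw hcQ hcH

/-- **(B2-L′), uniform form**: the split cells one rung up, for every `n ≥ 3`, decide `Ring2.Hypotheses.WeilClassesByComponent`
(every component, every `n ≥ 2`, every `d ≥ 1`, every `δ`). [cite: Markman2025SurveySecant, §11.5 Step 2 (p. 21)]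
[cite: Schoen1998HodgeWeilAddendum, 10 (Proposition), p. 332] -/
theorem weilClassesByComponent_of_split_components_succ
    (h : ∀ (n : ℕ), 2 ≤ n → ∀ (d : ℕ), 0 < d → WeilClassesComponent (n + 1) d (splitDiscriminantClass (n + 1) d)) :
    WeilClassesByComponent :=
  fun n hn d hd δ ↦ weilClassesComponent_of_split_component_succ hn hd (h n hn d hd) δ

/-- **(B2-L′), component-free form** (the theory seat's precision P1 on this file): the split cell one rung up already
gives the POLARISATION-FREE statement `WeilAlgebraicAll n d` — every rational `(n,n)` Weil class on EVERY complex abelian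
`2n`-fold `(A, φ)` with `φ ≫ φ = -d` is algebraic — of which `weilClassesComponent_of_split_component_succ` is the
weakening to one cell `δ`. Same kernel inputs (`stub_descend` + ring 2's «hyperbolic ⟹ in the split cell»).
[cite: Markman2025SurveySecant, §11.5 Step 2 (p. 21)] [cite: Schoen1998HodgeWeilAddendum, 10 (Proposition), p. 332] -/
theorem weilAlgebraicAll_of_split_component_succ {n d : ℕ} (hn : 2 ≤ n) (hd : 0 < d)
    (h : WeilClassesComponent (n + 1) d (splitDiscriminantClass (n + 1) d)) : WeilAlgebraicAll n d := by
  refine stub_descend n d hn hd ?_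
  intro B ψ e a hB hψ ha ha0 hhyp c hcW hc hH
  exact weilClasses_algebraic_of_isHyperbolicWeilType_of_split_component (by omega) hd h hB
    (isSmoothProjective_of_dim_eq' hB) hψ e ha ha0 hhyp hc hH hcW

end Summit.Ventures.HSemireg

end
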